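import Literature.Analysis.FluidPDE.OseenDuhamelEnvelopeCalculus
import Literature.Analysis.FluidPDE.NSBoundedMildOseenDuhamel
import Literature.Analysis.FluidPDE.NSBoundedMildSmoothing
import HarnessLib

/-!
# The Oseen–Duhamel term of a pair under a slice-wise envelope is weakly divergence free

Analysis/FluidPDE support file (everything proved) for the perturbation step of M. P. Coiculescu,
S. Palasek, *Non-uniqueness of smooth solutions of the Navier–Stokes equations from critical data*,
Invent. Math. 244 (2025) = arXiv:2503.14699, §5 ¶1: the slices `w(s)`, `s > 0`, of the
correction of Prop. 4.3 — sums of Duhamel terms `B¹_0(a,b)(s)` of pairs with time-singular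
envelopes — serve as data for the bounded mild theory of Koch–Nadirashvili–Seregin–Šverák, which
requires weakly divergence-free data. This file proves:

* `oseenDuhamel_cutoff_left_eq` — cutting the left field off below a time `σ ≥ t₀` moves the
  initial time: `B¹_{t₀}(𝟙_{τ>σ} a, b)(t) = B¹_σ(a, b)(t)`;
* `isWeaklyDivFree_oseenDuhamel_of_envelope` — `B¹_{t₀}(a,b)(t)` is weakly divergence free when
  `a, b` are jointly measurable with continuous envelopes on `(t₀, t]` and `(t-τ)^{-1/2}M_aM_b`
  integrable (it is the bounded pointwise limit of the weakly divergence-free bounded-field terms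
  `B¹_{σₙ}(a,b)(t)`, `σₙ ↓ t₀`: `isWeaklyDivFree_oseenDuhamel`, `tendsto_oseenDuhamel_of_dominated`,
  dominated convergence in the pairing with a test gradient).

## References

* G. Koch, N. Nadirashvili, G. Seregin, V. Šverák, Acta Math. 203 (2009) = arXiv:0709.3599, §3
  p. 6 (`∇·B(u,v) = 0` in the sense of distributions). [`KochNadirashviliSereginSverak2009`]
* M. P. Coiculescu, S. Palasek, Invent. Math. 244 (2025) = arXiv:2503.14699, Prop. 4.3, §5 ¶1.
  [`CoiculescuPalasek2025`]
-/

noncomputable section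

open MeasureTheory Set Function Filter TopologicalSpace InnerProductSpace Metric
open _root_.Topology
open scoped RealInnerProductSpace NNReal ENNReal

namespace Literature.Analysis.FluidPDE

variable {E : Type*} [NormedAddCommGroup E] [InnerProductSpace ℝ E] [FiniteDimensional ℝ E]
  [MeasurableSpace E] [BorelSpace E]

variable {a b : ℝ → E → E} {Ma Mb : ℝ → ℝ}

/-- **Cutting the left field off below `σ` moves the initial time**: for `t₀ ≤ σ`,
`B¹_{t₀}(𝟙_{τ>σ} a, b)(t)(x) = B¹_σ(a, b)(t)(x)` (the slice integrand vanishes for `τ ≤ σ`).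
[folklore] -/
theorem oseenDuhamel_cutoff_left_eq {t₀ σ t : ℝ} (hσ : t₀ ≤ σ) (a b : ℝ → E → E) (x : E) :
    oseenDuhamel 1 t₀ (fun τ y => if σ < τ then a τ y else 0) b t x = oseenDuhamel 1 σ a b t x := by
  rw [oseenDuhamel_one_eq_setIntegral_oseenSlice, oseenDuhamel_one_eq_setIntegral_oseenSlice]
  have hind : (fun τ => oseenSlice (t - τ) ((fun τ y => if σ < τ then a τ y else 0) τ) (b τ) x) =
      (Ioi σ).indicator fun τ => oseenSlice (t - τ) (a τ) (b τ) x := by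
    funext τ
    show oseenSlice (t - τ) (fun y => if σ < τ then a τ y else 0) (b τ) x = _
    by_cases h : σ < τ
    · rw [indicator_of_mem (mem_Ioi.2 h)]
      have hf : (fun y => if σ < τ then a τ y else 0) = a τ := funext fun y => if_pos h
      rw [hf]
    · rw [indicator_of_notMem (fun hm => h (mem_Ioi.1 hm))]
      have hf : (fun y => if σ < τ then a τ y else 0) = (0 : E → E) := funext fun y => if_neg h
      rw [hf]
      exact congrFun (oseenSlice_zero_left (t - τ) (b τ)) x
  rw [hind, setIntegral_indicator measurableSet_Ioi]
  have hset : Ioo t₀ t ∩ Ioi σ = Ioo σ t := by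
    ext τ
    simp only [mem_inter_iff, mem_Ioo, mem_Ioi]
    constructor
    · rintro ⟨⟨-, h2⟩, h3⟩; exact ⟨h3, h2⟩
    · rintro ⟨h1, h2⟩; exact ⟨⟨hσ.trans_lt h1, h2⟩, h1⟩
  rw [hset]

/-- **The Duhamel term of a pair under an envelope is weakly divergence free.** Let `a, b` be
jointly measurable with `‖a τ y‖ ≤ M_a(τ)`, `‖b τ y‖ ≤ M_b(τ)` on `(t₀, t)`, the envelopes
continuous on `(t₀, t]`, and `(t-τ)^{-1/2}M_a(τ)M_b(τ)` integrable on `(t₀, t)`. Then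
`B¹_{t₀}(a,b)(t)` is weakly divergence free: it is the bounded pointwise limit of the terms
`B¹_{σₙ}(a,b)(t)`, `σₙ ↓ t₀`, of fields bounded on `(σₙ, t)`, each weakly divergence free
(KNSS 2009, §3: `∇·B = 0`), and the pairing with a test gradient passes to the limit.
[cite: KochNadirashviliSereginSverak2009, §3 p. 6 (arXiv:0709.3599)] -/
theorem isWeaklyDivFree_oseenDuhamel_of_envelope (ham : Measurable (uncurry a))
    (hbm : Measurable (uncurry b)) {t₀ t : ℝ} (ht : t₀ < t)
    (ha : ∀ τ ∈ Ioo t₀ t, ∀ y, ‖a τ y‖ ≤ Ma τ) (hb : ∀ τ ∈ Ioo t₀ t, ∀ y, ‖b τ y‖ ≤ Mb τ)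
    (hMa : ContinuousOn Ma (Ioc t₀ t)) (hMb : ContinuousOn Mb (Ioc t₀ t))
    (henv : IntegrableOn (fun τ => (t - τ) ^ (-(1 / 2 : ℝ)) * (Ma τ * Mb τ)) (Ioo t₀ t)) :
    IsWeaklyDivFree (oseenDuhamel 1 t₀ a b t) := by
  haveI : CompleteSpace E := FiniteDimensional.complete ℝ E
  intro θ hθ
  have hθ1 : ContDiff ℝ 1 θ := hθ.contDiff.of_le (by exact_mod_cast le_top)
  have hgc : Continuous (gradient θ) := continuous_gradient_of_contDiff hθ1
  have hgs : HasCompactSupport (gradient θ) :=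
    (hθ.hasCompactSupport.fderiv (𝕜 := ℝ)).comp_left (g := (InnerProductSpace.toDual ℝ E).symm)
      (map_zero _)
  have hgi : Integrable (fun x => ‖gradient θ x‖) := (hgc.integrable_of_hasCompactSupport hgs).norm
  -- the cut-off times and fields
  set σ : ℕ → ℝ := fun n => t₀ + (t - t₀) / ((n : ℝ) + 2) with hσ
  have hσmem : ∀ n, σ n ∈ Ioo t₀ t := by
    intro n
    have h2 : (0 : ℝ) < (n : ℝ) + 2 := by positivity
    have h3 : (t - t₀) / ((n : ℝ) + 2) < t - t₀ := by
      rw [div_lt_iff₀ h2]; nlinarith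
    have h4 : 0 < (t - t₀) / ((n : ℝ) + 2) := div_pos (sub_pos.2 ht) h2
    exact ⟨by simp only [hσ]; linarith, by simp only [hσ]; linarith⟩
  have hσlim : Tendsto σ atTop (𝓝 t₀) := by
    have h2 : Tendsto (fun n : ℕ => ((n : ℝ) + 2)) atTop atTop :=
      tendsto_atTop_add_const_right _ _ tendsto_natCast_atTop_atTop
    have h1 : Tendsto (fun n : ℕ => (t - t₀) / ((n : ℝ) + 2)) atTop (𝓝 0) :=
      tendsto_const_nhds.div_atTop h2
    simpa [hσ] using h1.const_add t₀
  set an : ℕ → ℝ → E → E := fun n τ y => if σ n < τ then a τ y else 0 with han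
  have hanm : ∀ n, Measurable (uncurry (an n)) := by
    intro n
    have heq : uncurry (an n) = (Ioi (σ n) ×ˢ (univ : Set E)).piecewise (uncurry a) 0 := by
      funext q
      by_cases hq : σ n < q.1
      · rw [Set.piecewise_eq_of_mem _ _ _ (mk_mem_prod (mem_Ioi.2 hq) (mem_univ q.2))]
        exact if_pos hq
      · rw [Set.piecewise_eq_of_notMem _ _ _ (fun hm => hq (mem_Ioi.1 (mem_prod.1 hm).1))]
        exact if_neg hq
    rw [heq]
    exact ham.piecewise (measurableSet_Ioi.prod MeasurableSet.univ) measurable_const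
  have hMa0 : ∀ τ ∈ Ioo t₀ t, 0 ≤ Ma τ := fun τ hτ => (norm_nonneg _).trans (ha τ hτ 0)
  have han_le : ∀ n, ∀ τ ∈ Ioo t₀ t, ∀ y, ‖an n τ y‖ ≤ Ma τ := by
    intro n τ hτ y
    by_cases h : σ n < τ
    · simp only [han, if_pos h]; exact ha τ hτ y
    · simp only [han, if_neg h, norm_zero]; exact hMa0 τ hτ
  -- each cut-off term is a bounded-field term, weakly divergence free
  have hB_eq : ∀ n x, oseenDuhamel 1 t₀ (an n) b t x = oseenDuhamel 1 (σ n) a b t x := fun n x =>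
    oseenDuhamel_cutoff_left_eq (hσmem n).1.le a b x
  have hB_div : ∀ n, IsWeaklyDivFree (oseenDuhamel 1 (σ n) a b t) := by
    intro n
    have hsubI : Icc (σ n) t ⊆ Ioc t₀ t := fun τ hτ => ⟨(hσmem n).1.trans_le hτ.1, hτ.2⟩
    obtain ⟨CA, hCA⟩ := isCompact_Icc.exists_bound_of_continuousOn (hMa.mono hsubI)
    obtain ⟨CB, hCB⟩ := isCompact_Icc.exists_bound_of_continuousOn (hMb.mono hsubI)
    have hM : (0 : ℝ) ≤ max (max CA CB) 0 := le_max_right _ _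
    have haM : ∀ τ ∈ Ioo (σ n) t, ∀ y, ‖a τ y‖ ≤ max (max CA CB) 0 := fun τ hτ y =>
      ((ha τ ⟨(hσmem n).1.trans hτ.1, hτ.2⟩ y).trans ((le_abs_self _).trans
        ((Real.norm_eq_abs _).symm.le.trans (hCA τ ⟨hτ.1.le, hτ.2.le⟩)))).trans
        ((le_max_left _ _).trans (le_max_left _ _))
    have hbM : ∀ τ ∈ Ioo (σ n) t, ∀ y, ‖b τ y‖ ≤ max (max CA CB) 0 := fun τ hτ y =>
      ((hb τ ⟨(hσmem n).1.trans hτ.1, hτ.2⟩ y).trans ((le_abs_self _).trans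
        ((Real.norm_eq_abs _).symm.le.trans (hCB τ ⟨hτ.1.le, hτ.2.le⟩)))).trans
        ((le_max_right _ _).trans (le_max_left _ _))
    have h := isWeaklyDivFree_oseenDuhamel (ν := 1) one_pos (s := σ n) (T := t)
      ham.aestronglyMeasurable.restrict hbm.aestronglyMeasurable.restrict hM haM hbM (hσmem n).2 le_rfl
    simpa only [one_mul] using h
  -- pointwise convergence and a uniform bound
  have hlim : ∀ x, Tendsto (fun n => oseenDuhamel 1 (σ n) a b t x) atTop
      (𝓝 (oseenDuhamel 1 t₀ a b t x)) := by
    intro x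
    have h := tendsto_oseenDuhamel_of_dominated (t₀ := t₀) (t := t) (a := an) (b := fun _ => b)
      (aL := a) (bL := b) hanm (fun _ => hbm) han_le (fun _ => hb) henv ?_
      (fun τ _ y => tendsto_const_nhds) x
    · simpa only [hB_eq] using h
    · intro τ hτ y
      have hev : ∀ᶠ n in atTop, an n τ y = a τ y := by
        have h1 : ∀ᶠ n in atTop, σ n < τ := hσlim (Iio_mem_nhds hτ.1)
        filter_upwards [h1] with n hn
        simp only [han, if_pos hn]
      exact tendsto_const_nhds.congr' (hev.mono fun n hn => hn.symm)
  set D : ℝ := oseenSliceConst E * ∫ τ in Ioo t₀ t, (t - τ) ^ (-(1 / 2 : ℝ)) * (Ma τ * Mb τ) with hD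
  have hbound : ∀ n x, ‖oseenDuhamel 1 (σ n) a b t x‖ ≤ D := by
    intro n x
    rw [← hB_eq n x]
    exact norm_oseenDuhamel_le_setIntegral (han_le n) hb henv x
  -- dominated convergence in the pairing
  have hcont : ∀ n, Continuous (oseenDuhamel 1 (σ n) a b t) := by
    intro n
    have hsubI : Icc (σ n) t ⊆ Ioc t₀ t := fun τ hτ => ⟨(hσmem n).1.trans_le hτ.1, hτ.2⟩
    obtain ⟨CA, hCA⟩ := isCompact_Icc.exists_bound_of_continuousOn (hMa.mono hsubI)
    obtain ⟨CB, hCB⟩ := isCompact_Icc.exists_bound_of_continuousOn (hMb.mono hsubI)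
    have hM : (0 : ℝ) ≤ max (max CA CB) 0 := le_max_right _ _
    have haM : ∀ τ ∈ Ioo (σ n) t, ∀ y, ‖a τ y‖ ≤ max (max CA CB) 0 := fun τ hτ y =>
      ((ha τ ⟨(hσmem n).1.trans hτ.1, hτ.2⟩ y).trans ((le_abs_self _).trans
        ((Real.norm_eq_abs _).symm.le.trans (hCA τ ⟨hτ.1.le, hτ.2.le⟩)))).trans
        ((le_max_left _ _).trans (le_max_left _ _))
    have hbM : ∀ τ ∈ Ioo (σ n) t, ∀ y, ‖b τ y‖ ≤ max (max CA CB) 0 := fun τ hτ y =>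
      ((hb τ ⟨(hσmem n).1.trans hτ.1, hτ.2⟩ y).trans ((le_abs_self _).trans
        ((Real.norm_eq_abs _).symm.le.trans (hCB τ ⟨hτ.1.le, hτ.2.le⟩)))).trans
        ((le_max_right _ _).trans (le_max_left _ _))
    exact continuous_oseenDuhamel_slice (ν := 1) one_pos hM ham.aestronglyMeasurable.restrict
      hbm.aestronglyMeasurable.restrict haM hbM (hσmem n).2 le_rfl
  have hpair_lim : Tendsto (fun n => ∫ x, ⟪oseenDuhamel 1 (σ n) a b t x, gradient θ x⟫) atTop
      (𝓝 (∫ x, ⟪oseenDuhamel 1 t₀ a b t x, gradient θ x⟫)) := by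
    refine tendsto_integral_of_dominated_convergence (fun x => D * ‖gradient θ x‖)
      (fun n => ((hcont n).inner hgc).aestronglyMeasurable) (hgi.const_mul D)
      (fun n => Eventually.of_forall fun x => ?_) (Eventually.of_forall fun x => ?_)
    · exact (norm_inner_le_norm _ _).trans (mul_le_mul_of_nonneg_right (hbound n x) (norm_nonneg _))
    · exact ((hlim x).inner tendsto_const_nhds)
  have hzero : (fun n => ∫ x, ⟪oseenDuhamel 1 (σ n) a b t x, gradient θ x⟫) = fun _ => 0 :=
    funext fun n => hB_div n θ hθ
  rw [hzero] at hpair_lim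
  exact tendsto_nhds_unique hpair_lim tendsto_const_nhds

end Literature.Analysis.FluidPDE
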